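import Summits.HodgeConjecture.HodgeConjecture.Theorems.F0P3cStCharTSEllMassHEP          -- ★ (B3) (this seat): `exists_epFunction_H` — Kottwitz's EP function on `H_v`
import Summits.HodgeConjecture.HodgeConjecture.Theorems.F0P3cStCharTSEllMassHNull        -- ★ (B4) p852574 (this seat): `setIntegral_setOf_isLocalGRegular_eq_integral`
import Summits.HodgeConjecture.HodgeConjecture.Theorems.F0P3cStCharTSUpTrWIFHFull         -- ★ (H5‴) p852571 (F0P3a-p05): the Weyl integration formula on `H_v`, all sockets paid
import Summits.HodgeConjecture.HodgeConjecture.Theorems.F0P3cStCharTSCartanAllH           -- ★ (H1) p852410: `exists_cartanAllH` (`M_H = Z_H(γ₀)`)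
import Summits.HodgeConjecture.HodgeConjecture.Theorems.F0P3cStCharTSCartanSplitTwoH      -- ★ `not_isCompact_splitTorusH`
import Summits.HodgeConjecture.HodgeConjecture.Theorems.F0P3cStCharTSEllCartanCompactH    -- ★ `exists_centralizer_eq_map_splitTorusH_of_not_isCompact`
import Summits.HodgeConjecture.HodgeConjecture.Theorems.F0P3cStCharTSUpTrOrbInt           -- ★ (H3d) p852392 (my lineage g28): `exists_haar_cartanH_compactCore_eq_one`, `forall_isLocalGRegular_exists_isHaarMeasure_compactCore_centralizer_eq_one`
import Summits.HodgeConjecture.HodgeConjecture.Theorems.F0P3cStCharTSWeylHypMeasure       -- ★ `exists_conjFamily`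
import Literature.NumberTheory.Automorphic.LocalOrbitalMeasureRegular                     -- ★ `isMulRightInvariant_localEndoscopic`, `centralizer_comm_of_isLocalGRegular`
import Literature.NumberTheory.Automorphic.ClosedCompactDecomposition                     -- ★ `isInvInvariant_of_compactSpace`
import Literature.NumberTheory.Automorphic.OrbitalMeasureCanonicalExists                  -- ★ `OrbitalMeasureFamily.exists_isCanonical`
import HarnessLib

/-!
# F0 · P3c · line LH6 «StCharTS» — road «M5-H» (LEAD F0P3a-plan (g15) T14-41), brick (B5) «ELL-MASS-H»: THE ELLIPTIC WEYL MASS OF `H_v` IS ONE —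
# `Σ_{T ∈ SH} |Ω(T, H_v)|⁻¹ ∫_T D_H(t)² dμ_T = 1` over the compact Cartan representatives of `H_v = U(Φ₂)(L⁺_v) × U(Φ₁)(L⁺_v)` with their probability Haar measures
# [Rogawski1990, §12.5 p. 184, Cor. 12.5.4 proof p. 186 (at `ρ = {St_H(ξ)}`: «⟨χ_ρ, χ_ρ⟩_{H,e} = 1»); Kottwitz1988, §2 Thm. 2]

Cell `pub/hodgecm-mathlib`, crux H413 = `stmt-HodgeConjecture-24833` (lane `--supports … --as helper`), route HCCMUnconditional; seat F0P3a-p04 (g29), ROAD «M5-H» holder; LEAD T14-41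
fence (α) head (no new outer binder), desk HANDS 2026-09-02T20:05:55Z.  THEOREMS ONLY (no definition ∕ instance ∕ notation ∕ named fact ∕ `sorry`); ★-only imports.

WHAT.  `ellipticWeylMass_H_eq_one` — the hypothesis `hmass` of ★ (B6) `F0P3cStCharTSEllMassHJunction.packetCharHNorm_of_ellipticWeylMass` (F0P3b-p01 (g21), p852627) BYTE FOR
BYTE, from the RUNG 0 v8 Cartan binders `hKHO hcovHO hncHO hHaarHO hprobHO` (★ `F0P3cStCharTSRung0Eight` :143–:147, TEXTS VERBATIM) and the closed form `hdh` (= `eDH` :167 with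
`𝔇.DH ↦ dh`; = ★ (H5″)'s `hdh`).  NO measure on `H_v` and NO orbital family appear in the statement (fence (α)): a Haar measure `νHv` (★ `isMulRightInvariant_localEndoscopic`)
and a canonical family `mHv` (★ `OrbitalMeasureFamily.exists_isCanonical` over ★ `forall_isLocalGRegular_exists_isHaarMeasure_compactCore_centralizer_eq_one`) are INTRODUCED AND
ELIMINATED inside the proof.  With the block's pins this is (M5) `𝔇.PacketCharHNorm` at `ρ = {St_H(ξ)}` — in house, Mathlib-only, no printed input.

PROOF (census §4.2 «EP-H»).  Take Kottwitz's Euler–Poincaré function `f_H` on `H_v` (★ (B3) `exists_epFunction_H`: mass one, orbital integral `1` at elliptic `G`-regular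
classes, `0` at split ones) and apply the Weyl integration formula on `H_v` (★ (H5‴) `integral_mul_classFun_eq_finsetSum_DH_classOrbitalIntegral_H_of_splitSocket` with ★
`hJacNC_of_splitDock`) to `f_H · 1` on the Cartan system `insert M_H SH` (`M_H = M₂ × U(Φ₁)(L⁺_v)` the split Cartan, `= Z_H(γ₀)` by ★ (H1); coverage from `hcovHO` (compact
centralisers) and ★ `exists_centralizer_eq_map_splitTorusH_of_not_isCompact` (non-compact ones); irredundancy from `hncHO` and ★ `not_isCompact_splitTorusH`; conjugation
families ★ `exists_conjFamily` over ★ `centralizer_comm_of_isLocalGRegular`; torus measures `μTHf` on `SH` — probability on a compact group, hence compact-core mass one and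
inversion invariant (★ `isInvInvariant_of_compactSpace`) — and the ★ (H3d) measure on `M_H`): `1 = ∫ f_H = Σ_{T ∈ SH} |Ω(T)|⁻¹ ∫_{T^{G-reg}} dh² · 1 + |Ω(M_H)|⁻¹ ∫_{M_H^{G-reg}} dh² · 0`,
and `∫_{T^{G-reg}} dh² = ∫_T dh²` by ★ (B4) (`Z_H(t) = T` for `G`-regular `t ∈ T`: ★ `centralizer_eq_of_mem_centralizer_of_isLocalGRegular`).

* §1 `ellipticWeylMass_H_eq_one_of_epFunction` — the identity for ANY Haar `νHv`, canonical `mHv` and ANY function `f_H` with the four EP properties (the (B5-core) letters).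
* §2 **`ellipticWeylMass_H_eq_one`** — fence (α) head.
HONEST LABEL: count-neutral helper until the (δ) rider (an LH6 leaf edition after UP-TR's ED. 26, desk-priced) consumes ★ (B6) with `hmass := ellipticWeylMass_H_eq_one …`; then the
block consequent (M5) leaves the PRINT list (block consequents −1, organs 2 = 2, registries untouched); HC_CM is proved only modulo the 7 printed citations (2 remaining named
inputs: hLiu418 = `stmt-HodgeConjecture-24832`, h413 = `stmt-HodgeConjecture-24833`) until rung 0 closes.

## References
* [Rogawski1990] J. D. Rogawski, *Automorphic Representations of Unitary Groups in Three Variables*, Ann. of Math. Stud. 123 (1990): §12.5 pp. 182–186 (Weyl integration formula,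
  elliptic inner product, Cor. 12.5.4); §12.6 p. 187; §3.6 pp. 28–31; §4.3 (4.3.1) p. 43.
* [Kottwitz1988] R. E. Kottwitz, *Tamagawa numbers*, Ann. of Math. 127 (1988), 629–646, §2 Theorem 2.
* [HarishChandra1970] Harish-Chandra (notes by G. van Dijk), *Harmonic Analysis on Reductive p-adic Groups*, LNM 162 (1970), Lemma 22, Lemma 42.
-/

set_option autoImplicit false
-- the mandated namespace has the single-problem summit's repeated segment (`HodgeConjecture.HodgeConjecture`)
set_option linter.dupNamespace false

noncomputable section

open NumberField IsDedekindDomain MeasureTheory Measure Topology Set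
open scoped Matrix MatrixGroups ENNReal NNReal Classical
open Literature.NumberTheory.Rogawski1990 Literature.NumberTheory.Automorphic Literature.NumberTheory.Automorphic.UnitaryGroup
open Literature.NumberTheory.GaloisRepresentations
open Literature.MeasureTheory.Group
open Summit.HodgeConjecture.HodgeConjecture.Cruxes.H413

namespace Summit.HodgeConjecture.HodgeConjecture.Cruxes.H413.F0P3cStCharTSEllMassH

section CM

variable (L : Type) [Field L] [NumberField L] [IsCMField L] (v : HeightOneSpectrum (𝓞 ↥(maximalRealSubfield L)))

/-! ## §1 The elliptic Weyl mass from ANY Euler–Poincaré function -/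

set_option maxHeartbeats 3200000 in
set_option synthInstance.maxHeartbeats 400000 in
-- instance-term unification on the endoscopic local carrier (quotient measures per representative), as ★ (H5)∕(H5′)∕(H5″)
/-- **(B5-core) THE ELLIPTIC WEYL MASS OF `H_v` FROM AN EULER–POINCARÉ FUNCTION.**  `v` non-split; `SH, μTHf` with the RUNG 0 v8 Cartan binders `hKHO hcovHO hncHO hHaarHO hprobHO`
(texts of ★ `F0P3cStCharTSRung0Eight` :143–:147); `dh` the closed form `hdh` (★ (H5″)'s letter); `νHv` any Haar measure on `H_v`, `mHv` canonical for (`IsLocalGRegular`, `νHv`);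
`f_H` measurable, integrable, of mass one, with orbital integral `1` at `G`-regular classes with compact centraliser and `0` at the others.  Then
`Σ_{T ∈ SH} (weylOrder T)⁻¹ ∫_T dh² dμTHf = 1`. [cite: Rogawski1990, §12.5 pp. 182–186] [cite: Kottwitz1988, §2 Theorem 2] [cite: HarishChandra1970, Lemma 22; Lemma 42] -/
theorem ellipticWeylMass_H_eq_one_of_epFunction (hns : ∀ w : PlacesOver L v, IsCMField.complexConj L • w.1 = w.1)
    [MeasurableSpace ((UnitaryGroup.cmDatum L 2 (Matrix.of fun i j : Fin 2 => if i.val + j.val + 1 = 2 then (1 : L) else 0)).Local v ×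
      (UnitaryGroup.cmDatum L 1 (Matrix.of fun i j : Fin 1 => if i.val + j.val + 1 = 1 then (1 : L) else 0)).Local v)] [BorelSpace ((UnitaryGroup.cmDatum L 2 (Matrix.of fun i j : Fin 2 => if i.val + j.val + 1 = 2 then (1 : L) else 0)).Local v ×
      (UnitaryGroup.cmDatum L 1 (Matrix.of fun i j : Fin 1 => if i.val + j.val + 1 = 1 then (1 : L) else 0)).Local v)]
    [∀ a : (UnitaryGroup.cmDatum L 2 (Matrix.of fun i j : Fin 2 => if i.val + j.val + 1 = 2 then (1 : L) else 0)).Local v ×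
      (UnitaryGroup.cmDatum L 1 (Matrix.of fun i j : Fin 1 => if i.val + j.val + 1 = 1 then (1 : L) else 0)).Local v, MeasurableSpace (((UnitaryGroup.cmDatum L 2 (Matrix.of fun i j : Fin 2 => if i.val + j.val + 1 = 2 then (1 : L) else 0)).Local v ×
      (UnitaryGroup.cmDatum L 1 (Matrix.of fun i j : Fin 1 => if i.val + j.val + 1 = 1 then (1 : L) else 0)).Local v) ⧸ Subgroup.centralizer ({a} : Set ((UnitaryGroup.cmDatum L 2 (Matrix.of fun i j : Fin 2 => if i.val + j.val + 1 = 2 then (1 : L) else 0)).Local v ×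
      (UnitaryGroup.cmDatum L 1 (Matrix.of fun i j : Fin 1 => if i.val + j.val + 1 = 1 then (1 : L) else 0)).Local v)))]
    [∀ a : (UnitaryGroup.cmDatum L 2 (Matrix.of fun i j : Fin 2 => if i.val + j.val + 1 = 2 then (1 : L) else 0)).Local v ×
      (UnitaryGroup.cmDatum L 1 (Matrix.of fun i j : Fin 1 => if i.val + j.val + 1 = 1 then (1 : L) else 0)).Local v, BorelSpace (((UnitaryGroup.cmDatum L 2 (Matrix.of fun i j : Fin 2 => if i.val + j.val + 1 = 2 then (1 : L) else 0)).Local v ×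
      (UnitaryGroup.cmDatum L 1 (Matrix.of fun i j : Fin 1 => if i.val + j.val + 1 = 1 then (1 : L) else 0)).Local v) ⧸ Subgroup.centralizer ({a} : Set ((UnitaryGroup.cmDatum L 2 (Matrix.of fun i j : Fin 2 => if i.val + j.val + 1 = 2 then (1 : L) else 0)).Local v ×
      (UnitaryGroup.cmDatum L 1 (Matrix.of fun i j : Fin 1 => if i.val + j.val + 1 = 1 then (1 : L) else 0)).Local v)))]
    (νHv : Measure ((UnitaryGroup.cmDatum L 2 (Matrix.of fun i j : Fin 2 => if i.val + j.val + 1 = 2 then (1 : L) else 0)).Local v ×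
      (UnitaryGroup.cmDatum L 1 (Matrix.of fun i j : Fin 1 => if i.val + j.val + 1 = 1 then (1 : L) else 0)).Local v)) [νHv.IsHaarMeasure] [νHv.IsMulRightInvariant]
    {mHv : OrbitalMeasureFamily ((UnitaryGroup.cmDatum L 2 (Matrix.of fun i j : Fin 2 => if i.val + j.val + 1 = 2 then (1 : L) else 0)).Local v ×
      (UnitaryGroup.cmDatum L 1 (Matrix.of fun i j : Fin 1 => if i.val + j.val + 1 = 1 then (1 : L) else 0)).Local v)} (hcanH : mHv.IsCanonical (IsLocalGRegular L v) νHv)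
    (SH : Finset (Subgroup ((UnitaryGroup.cmDatum L 2 (Matrix.of fun i j : Fin 2 => if i.val + j.val + 1 = 2 then (1 : L) else 0)).Local v ×
      (UnitaryGroup.cmDatum L 1 (Matrix.of fun i j : Fin 1 => if i.val + j.val + 1 = 1 then (1 : L) else 0)).Local v))) (μTHf : (T' : Subgroup ((UnitaryGroup.cmDatum L 2 (Matrix.of fun i j : Fin 2 => if i.val + j.val + 1 = 2 then (1 : L) else 0)).Local v ×
      (UnitaryGroup.cmDatum L 1 (Matrix.of fun i j : Fin 1 => if i.val + j.val + 1 = 1 then (1 : L) else 0)).Local v)) → Measure ↥T')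
    (hKHO : ∀ T' ∈ SH, IsCompact (T' : Set ((UnitaryGroup.cmDatum L 2 (Matrix.of fun i j : Fin 2 => if i.val + j.val + 1 = 2 then (1 : L) else 0)).Local v ×
      (UnitaryGroup.cmDatum L 1 (Matrix.of fun i j : Fin 1 => if i.val + j.val + 1 = 1 then (1 : L) else 0)).Local v)) ∧ ∃ γ₀ : (UnitaryGroup.cmDatum L 2 (Matrix.of fun i j : Fin 2 => if i.val + j.val + 1 = 2 then (1 : L) else 0)).Local v ×
      (UnitaryGroup.cmDatum L 1 (Matrix.of fun i j : Fin 1 => if i.val + j.val + 1 = 1 then (1 : L) else 0)).Local v, IsLocalGRegular L v γ₀ ∧ T' = Subgroup.centralizer ({γ₀} : Set ((UnitaryGroup.cmDatum L 2 (Matrix.of fun i j : Fin 2 => if i.val + j.val + 1 = 2 then (1 : L) else 0)).Local v ×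
      (UnitaryGroup.cmDatum L 1 (Matrix.of fun i j : Fin 1 => if i.val + j.val + 1 = 1 then (1 : L) else 0)).Local v)))
    (hcovHO : ∀ γ₀ : (UnitaryGroup.cmDatum L 2 (Matrix.of fun i j : Fin 2 => if i.val + j.val + 1 = 2 then (1 : L) else 0)).Local v ×
      (UnitaryGroup.cmDatum L 1 (Matrix.of fun i j : Fin 1 => if i.val + j.val + 1 = 1 then (1 : L) else 0)).Local v, IsLocalGRegular L v γ₀ → IsCompact ((Subgroup.centralizer ({γ₀} : Set ((UnitaryGroup.cmDatum L 2 (Matrix.of fun i j : Fin 2 => if i.val + j.val + 1 = 2 then (1 : L) else 0)).Local v ×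
      (UnitaryGroup.cmDatum L 1 (Matrix.of fun i j : Fin 1 => if i.val + j.val + 1 = 1 then (1 : L) else 0)).Local v)) : Subgroup ((UnitaryGroup.cmDatum L 2 (Matrix.of fun i j : Fin 2 => if i.val + j.val + 1 = 2 then (1 : L) else 0)).Local v ×
      (UnitaryGroup.cmDatum L 1 (Matrix.of fun i j : Fin 1 => if i.val + j.val + 1 = 1 then (1 : L) else 0)).Local v)) : Set ((UnitaryGroup.cmDatum L 2 (Matrix.of fun i j : Fin 2 => if i.val + j.val + 1 = 2 then (1 : L) else 0)).Local v ×
      (UnitaryGroup.cmDatum L 1 (Matrix.of fun i j : Fin 1 => if i.val + j.val + 1 = 1 then (1 : L) else 0)).Local v)) →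
      ∃ T ∈ SH, ∃ x : (UnitaryGroup.cmDatum L 2 (Matrix.of fun i j : Fin 2 => if i.val + j.val + 1 = 2 then (1 : L) else 0)).Local v ×
      (UnitaryGroup.cmDatum L 1 (Matrix.of fun i j : Fin 1 => if i.val + j.val + 1 = 1 then (1 : L) else 0)).Local v, Subgroup.centralizer ({x * γ₀ * x⁻¹} : Set ((UnitaryGroup.cmDatum L 2 (Matrix.of fun i j : Fin 2 => if i.val + j.val + 1 = 2 then (1 : L) else 0)).Local v ×
      (UnitaryGroup.cmDatum L 1 (Matrix.of fun i j : Fin 1 => if i.val + j.val + 1 = 1 then (1 : L) else 0)).Local v)) = T)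
    (hncHO : ∀ T' ∈ SH, ∀ T'' ∈ SH, (∃ x : (UnitaryGroup.cmDatum L 2 (Matrix.of fun i j : Fin 2 => if i.val + j.val + 1 = 2 then (1 : L) else 0)).Local v ×
      (UnitaryGroup.cmDatum L 1 (Matrix.of fun i j : Fin 1 => if i.val + j.val + 1 = 1 then (1 : L) else 0)).Local v, T'.map (MulAut.conj x).toMonoidHom = T'') → T' = T'')
    (hHaarHO : ∀ T' ∈ SH, (μTHf T').IsHaarMeasure) (hprobHO : ∀ T' ∈ SH, IsProbabilityMeasure (μTHf T'))
    (dh : ((UnitaryGroup.cmDatum L 2 (Matrix.of fun i j : Fin 2 => if i.val + j.val + 1 = 2 then (1 : L) else 0)).Local v ×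
      (UnitaryGroup.cmDatum L 1 (Matrix.of fun i j : Fin 1 => if i.val + j.val + 1 = 1 then (1 : L) else 0)).Local v) → ℝ)
    (hdh : ∀ s : (UnitaryGroup.cmDatum L 2 (Matrix.of fun i j : Fin 2 => if i.val + j.val + 1 = 2 then (1 : L) else 0)).Local v ×
      (UnitaryGroup.cmDatum L 1 (Matrix.of fun i j : Fin 1 => if i.val + j.val + 1 = 1 then (1 : L) else 0)).Local v, dh s = ((NNReal.sqrt (NNReal.sqrt ((∏ w : PlacesOver L v, IsNonarchimedeanLocalField.normAbs (w.1.adicCompletion L) (((s.1.val : GL (Fin 2) (UnitaryGroup.LocalRing L v)).val.charpoly.discr) w)) * (∏ w : PlacesOver L v, IsNonarchimedeanLocalField.normAbs (w.1.adicCompletion L) (((s.1.val : GL (Fin 2) (UnitaryGroup.LocalRing L v)).val.det) w))⁻¹)) : ℝ≥0) : ℝ))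
    (fH : ((UnitaryGroup.cmDatum L 2 (Matrix.of fun i j : Fin 2 => if i.val + j.val + 1 = 2 then (1 : L) else 0)).Local v ×
      (UnitaryGroup.cmDatum L 1 (Matrix.of fun i j : Fin 1 => if i.val + j.val + 1 = 1 then (1 : L) else 0)).Local v) → ℂ) (hfm : Measurable fH) (hfi : Integrable fH νHv) (hf1 : ∫ h, fH h ∂νHv = 1)
    (hfE : ∀ γH : (UnitaryGroup.cmDatum L 2 (Matrix.of fun i j : Fin 2 => if i.val + j.val + 1 = 2 then (1 : L) else 0)).Local v ×
      (UnitaryGroup.cmDatum L 1 (Matrix.of fun i j : Fin 1 => if i.val + j.val + 1 = 1 then (1 : L) else 0)).Local v, IsLocalGRegular L v γH → IsCompact ((Subgroup.centralizer ({γH} : Set ((UnitaryGroup.cmDatum L 2 (Matrix.of fun i j : Fin 2 => if i.val + j.val + 1 = 2 then (1 : L) else 0)).Local v ×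
      (UnitaryGroup.cmDatum L 1 (Matrix.of fun i j : Fin 1 => if i.val + j.val + 1 = 1 then (1 : L) else 0)).Local v)) : Subgroup ((UnitaryGroup.cmDatum L 2 (Matrix.of fun i j : Fin 2 => if i.val + j.val + 1 = 2 then (1 : L) else 0)).Local v ×
      (UnitaryGroup.cmDatum L 1 (Matrix.of fun i j : Fin 1 => if i.val + j.val + 1 = 1 then (1 : L) else 0)).Local v)) : Set ((UnitaryGroup.cmDatum L 2 (Matrix.of fun i j : Fin 2 => if i.val + j.val + 1 = 2 then (1 : L) else 0)).Local v ×
      (UnitaryGroup.cmDatum L 1 (Matrix.of fun i j : Fin 1 => if i.val + j.val + 1 = 1 then (1 : L) else 0)).Local v)) →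
      classOrbitalIntegral mHv fH (ConjClasses.mk γH) = 1)
    (hfN : ∀ γH : (UnitaryGroup.cmDatum L 2 (Matrix.of fun i j : Fin 2 => if i.val + j.val + 1 = 2 then (1 : L) else 0)).Local v ×
      (UnitaryGroup.cmDatum L 1 (Matrix.of fun i j : Fin 1 => if i.val + j.val + 1 = 1 then (1 : L) else 0)).Local v, IsLocalGRegular L v γH → ¬ IsCompact ((Subgroup.centralizer ({γH} : Set ((UnitaryGroup.cmDatum L 2 (Matrix.of fun i j : Fin 2 => if i.val + j.val + 1 = 2 then (1 : L) else 0)).Local v ×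
      (UnitaryGroup.cmDatum L 1 (Matrix.of fun i j : Fin 1 => if i.val + j.val + 1 = 1 then (1 : L) else 0)).Local v)) : Subgroup ((UnitaryGroup.cmDatum L 2 (Matrix.of fun i j : Fin 2 => if i.val + j.val + 1 = 2 then (1 : L) else 0)).Local v ×
      (UnitaryGroup.cmDatum L 1 (Matrix.of fun i j : Fin 1 => if i.val + j.val + 1 = 1 then (1 : L) else 0)).Local v)) : Set ((UnitaryGroup.cmDatum L 2 (Matrix.of fun i j : Fin 2 => if i.val + j.val + 1 = 2 then (1 : L) else 0)).Local v ×
      (UnitaryGroup.cmDatum L 1 (Matrix.of fun i j : Fin 1 => if i.val + j.val + 1 = 1 then (1 : L) else 0)).Local v)) →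
      classOrbitalIntegral mHv fH (ConjClasses.mk γH) = 0) :
    ∑ T ∈ SH, ((Ch12Sec5.weylOrder T : ℂ))⁻¹ * ∫ t : ↥T, ((dh (t : ((UnitaryGroup.cmDatum L 2 (Matrix.of fun i j : Fin 2 => if i.val + j.val + 1 = 2 then (1 : L) else 0)).Local v ×
      (UnitaryGroup.cmDatum L 1 (Matrix.of fun i j : Fin 1 => if i.val + j.val + 1 = 1 then (1 : L) else 0)).Local v)) : ℂ) ^ 2) ∂(μTHf T) = 1 := by
  -- the split Cartan `M_H` of `H_v`: a centraliser of a `G`-regular element, NOT compact, hence not in `SH`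
  set MH : Subgroup ((UnitaryGroup.cmDatum L 2 (Matrix.of fun i j : Fin 2 => if i.val + j.val + 1 = 2 then (1 : L) else 0)).Local v ×
      (UnitaryGroup.cmDatum L 1 (Matrix.of fun i j : Fin 1 => if i.val + j.val + 1 = 1 then (1 : L) else 0)).Local v) := ((cmBorelTriple L 2 v).M).prod ⊤ with hMHdef
  have hMHnc : ¬ IsCompact (MH : Set ((UnitaryGroup.cmDatum L 2 (Matrix.of fun i j : Fin 2 => if i.val + j.val + 1 = 2 then (1 : L) else 0)).Local v ×
      (UnitaryGroup.cmDatum L 1 (Matrix.of fun i j : Fin 1 => if i.val + j.val + 1 = 1 then (1 : L) else 0)).Local v)) := F0P3cStCharTSCartanSplitTwoH.not_isCompact_splitTorusH L v hns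
  have hMHnot : MH ∉ SH := fun h => hMHnc (hKHO MH h).1
  obtain ⟨C', hMC', hZ', -, -, -⟩ := F0P3cStCharTSCartanAllH.exists_cartanAllH L v hns
  obtain ⟨γM, hγM, hMZ⟩ := hZ' MH hMC'
  -- the Cartan system `SHall = insert M_H SH`, its shape
  set SHall : Finset (Subgroup ((UnitaryGroup.cmDatum L 2 (Matrix.of fun i j : Fin 2 => if i.val + j.val + 1 = 2 then (1 : L) else 0)).Local v ×
      (UnitaryGroup.cmDatum L 1 (Matrix.of fun i j : Fin 1 => if i.val + j.val + 1 = 1 then (1 : L) else 0)).Local v)) := insert MH SH with hSHall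
  have hS : ∀ T ∈ SHall, ∃ γ₀ : (UnitaryGroup.cmDatum L 2 (Matrix.of fun i j : Fin 2 => if i.val + j.val + 1 = 2 then (1 : L) else 0)).Local v ×
      (UnitaryGroup.cmDatum L 1 (Matrix.of fun i j : Fin 1 => if i.val + j.val + 1 = 1 then (1 : L) else 0)).Local v, IsLocalGRegular L v γ₀ ∧ T = Subgroup.centralizer ({γ₀} : Set ((UnitaryGroup.cmDatum L 2 (Matrix.of fun i j : Fin 2 => if i.val + j.val + 1 = 2 then (1 : L) else 0)).Local v ×
      (UnitaryGroup.cmDatum L 1 (Matrix.of fun i j : Fin 1 => if i.val + j.val + 1 = 1 then (1 : L) else 0)).Local v)) := by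
    intro T hT
    rcases Finset.mem_insert.1 hT with rfl | h
    · exact ⟨γM, hγM, hMZ⟩
    · exact (hKHO T h).2
  have hcpt : ∀ T ∈ SHall, T ≠ MH → IsCompact (T : Set ((UnitaryGroup.cmDatum L 2 (Matrix.of fun i j : Fin 2 => if i.val + j.val + 1 = 2 then (1 : L) else 0)).Local v ×
      (UnitaryGroup.cmDatum L 1 (Matrix.of fun i j : Fin 1 => if i.val + j.val + 1 = 1 then (1 : L) else 0)).Local v)) := by
    intro T hT hne
    rcases Finset.mem_insert.1 hT with rfl | h
    · exact absurd rfl hne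
    · exact (hKHO T h).1
  -- conjugation inside centralisers
  have key : ∀ (x h γ : ((UnitaryGroup.cmDatum L 2 (Matrix.of fun i j : Fin 2 => if i.val + j.val + 1 = 2 then (1 : L) else 0)).Local v ×
      (UnitaryGroup.cmDatum L 1 (Matrix.of fun i j : Fin 1 => if i.val + j.val + 1 = 1 then (1 : L) else 0)).Local v)), x * h * x⁻¹ ∈ Subgroup.centralizer ({x * γ * x⁻¹} : Set ((UnitaryGroup.cmDatum L 2 (Matrix.of fun i j : Fin 2 => if i.val + j.val + 1 = 2 then (1 : L) else 0)).Local v ×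
      (UnitaryGroup.cmDatum L 1 (Matrix.of fun i j : Fin 1 => if i.val + j.val + 1 = 1 then (1 : L) else 0)).Local v)) ↔ h ∈ Subgroup.centralizer ({γ} : Set ((UnitaryGroup.cmDatum L 2 (Matrix.of fun i j : Fin 2 => if i.val + j.val + 1 = 2 then (1 : L) else 0)).Local v ×
      (UnitaryGroup.cmDatum L 1 (Matrix.of fun i j : Fin 1 => if i.val + j.val + 1 = 1 then (1 : L) else 0)).Local v)) := by
    intro x h γ
    rw [Subgroup.mem_centralizer_singleton_iff, Subgroup.mem_centralizer_singleton_iff]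
    have c1 : x * h * x⁻¹ * (x * γ * x⁻¹) = x * (h * γ) * x⁻¹ := by simp only [mul_assoc, inv_mul_cancel_left]
    have c2 : x * γ * x⁻¹ * (x * h * x⁻¹) = x * (γ * h) * x⁻¹ := by simp only [mul_assoc, inv_mul_cancel_left]
    rw [c1, c2]
    constructor
    · intro e
      exact mul_left_cancel (mul_right_cancel e)
    · intro e
      rw [e]
  have hcov : ∀ s : (UnitaryGroup.cmDatum L 2 (Matrix.of fun i j : Fin 2 => if i.val + j.val + 1 = 2 then (1 : L) else 0)).Local v ×
      (UnitaryGroup.cmDatum L 1 (Matrix.of fun i j : Fin 1 => if i.val + j.val + 1 = 1 then (1 : L) else 0)).Local v, IsLocalGRegular L v s →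
      ∃ T ∈ SHall, ∃ x : (UnitaryGroup.cmDatum L 2 (Matrix.of fun i j : Fin 2 => if i.val + j.val + 1 = 2 then (1 : L) else 0)).Local v ×
      (UnitaryGroup.cmDatum L 1 (Matrix.of fun i j : Fin 1 => if i.val + j.val + 1 = 1 then (1 : L) else 0)).Local v, ∀ h : (UnitaryGroup.cmDatum L 2 (Matrix.of fun i j : Fin 2 => if i.val + j.val + 1 = 2 then (1 : L) else 0)).Local v ×
      (UnitaryGroup.cmDatum L 1 (Matrix.of fun i j : Fin 1 => if i.val + j.val + 1 = 1 then (1 : L) else 0)).Local v, h ∈ Subgroup.centralizer ({s} : Set ((UnitaryGroup.cmDatum L 2 (Matrix.of fun i j : Fin 2 => if i.val + j.val + 1 = 2 then (1 : L) else 0)).Local v ×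
      (UnitaryGroup.cmDatum L 1 (Matrix.of fun i j : Fin 1 => if i.val + j.val + 1 = 1 then (1 : L) else 0)).Local v)) ↔ x⁻¹ * h * x ∈ T := by
    intro s hs
    by_cases hc : IsCompact ((Subgroup.centralizer ({s} : Set ((UnitaryGroup.cmDatum L 2 (Matrix.of fun i j : Fin 2 => if i.val + j.val + 1 = 2 then (1 : L) else 0)).Local v ×
      (UnitaryGroup.cmDatum L 1 (Matrix.of fun i j : Fin 1 => if i.val + j.val + 1 = 1 then (1 : L) else 0)).Local v)) : Subgroup ((UnitaryGroup.cmDatum L 2 (Matrix.of fun i j : Fin 2 => if i.val + j.val + 1 = 2 then (1 : L) else 0)).Local v ×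
      (UnitaryGroup.cmDatum L 1 (Matrix.of fun i j : Fin 1 => if i.val + j.val + 1 = 1 then (1 : L) else 0)).Local v)) : Set ((UnitaryGroup.cmDatum L 2 (Matrix.of fun i j : Fin 2 => if i.val + j.val + 1 = 2 then (1 : L) else 0)).Local v ×
      (UnitaryGroup.cmDatum L 1 (Matrix.of fun i j : Fin 1 => if i.val + j.val + 1 = 1 then (1 : L) else 0)).Local v))
    · obtain ⟨T, hT, x, hxT⟩ := hcovHO s hs hc
      refine ⟨T, Finset.mem_insert_of_mem hT, x⁻¹, fun h => ?_⟩
      rw [← hxT, inv_inv, key]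
    · obtain ⟨u, hu⟩ := F0P3cStCharTSEllCartanCompactH.exists_centralizer_eq_map_splitTorusH_of_not_isCompact L v hns s hs hc
      refine ⟨MH, Finset.mem_insert_self _ _, u, fun h => ?_⟩
      rw [hu, Subgroup.mem_map_equiv, MulAut.conj_symm_apply]
      rfl
  have hcT : ∀ S : Subgroup ((UnitaryGroup.cmDatum L 2 (Matrix.of fun i j : Fin 2 => if i.val + j.val + 1 = 2 then (1 : L) else 0)).Local v ×
      (UnitaryGroup.cmDatum L 1 (Matrix.of fun i j : Fin 1 => if i.val + j.val + 1 = 1 then (1 : L) else 0)).Local v), IsCompact (S : Set ((UnitaryGroup.cmDatum L 2 (Matrix.of fun i j : Fin 2 => if i.val + j.val + 1 = 2 then (1 : L) else 0)).Local v ×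
      (UnitaryGroup.cmDatum L 1 (Matrix.of fun i j : Fin 1 => if i.val + j.val + 1 = 1 then (1 : L) else 0)).Local v)) → ∀ z : (UnitaryGroup.cmDatum L 2 (Matrix.of fun i j : Fin 2 => if i.val + j.val + 1 = 2 then (1 : L) else 0)).Local v ×
      (UnitaryGroup.cmDatum L 1 (Matrix.of fun i j : Fin 1 => if i.val + j.val + 1 = 1 then (1 : L) else 0)).Local v, IsCompact ((S.map (MulAut.conj z).toMonoidHom : Subgroup ((UnitaryGroup.cmDatum L 2 (Matrix.of fun i j : Fin 2 => if i.val + j.val + 1 = 2 then (1 : L) else 0)).Local v ×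
      (UnitaryGroup.cmDatum L 1 (Matrix.of fun i j : Fin 1 => if i.val + j.val + 1 = 1 then (1 : L) else 0)).Local v)) : Set ((UnitaryGroup.cmDatum L 2 (Matrix.of fun i j : Fin 2 => if i.val + j.val + 1 = 2 then (1 : L) else 0)).Local v ×
      (UnitaryGroup.cmDatum L 1 (Matrix.of fun i j : Fin 1 => if i.val + j.val + 1 = 1 then (1 : L) else 0)).Local v)) := by
    intro S hSc z
    rw [Subgroup.coe_map]
    exact hSc.image (IsTopologicalGroup.continuous_conj z)
  have hnc : ∀ T ∈ SHall, ∀ T' ∈ SHall, T ≠ T' → ∀ y : (UnitaryGroup.cmDatum L 2 (Matrix.of fun i j : Fin 2 => if i.val + j.val + 1 = 2 then (1 : L) else 0)).Local v ×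
      (UnitaryGroup.cmDatum L 1 (Matrix.of fun i j : Fin 1 => if i.val + j.val + 1 = 1 then (1 : L) else 0)).Local v, ¬ ∀ h : (UnitaryGroup.cmDatum L 2 (Matrix.of fun i j : Fin 2 => if i.val + j.val + 1 = 2 then (1 : L) else 0)).Local v ×
      (UnitaryGroup.cmDatum L 1 (Matrix.of fun i j : Fin 1 => if i.val + j.val + 1 = 1 then (1 : L) else 0)).Local v, h ∈ T' ↔ y⁻¹ * h * y ∈ T := by
    intro T hT T' hT' hne y hy
    have hmap : T.map (MulAut.conj y).toMonoidHom = T' := by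
      ext h; rw [Subgroup.mem_map_equiv, MulAut.conj_symm_apply]; exact (hy h).symm
    have hmap' : T'.map (MulAut.conj y⁻¹).toMonoidHom = T := by
      ext h
      rw [Subgroup.mem_map_equiv, MulAut.conj_symm_apply, inv_inv, hy]
      have e : y⁻¹ * (y * h * y⁻¹) * y = h := by simp only [mul_assoc, inv_mul_cancel_left, inv_mul_cancel, mul_one]
      rw [e]
    rcases Finset.mem_insert.1 hT with rfl | hT1 <;> rcases Finset.mem_insert.1 hT' with rfl | hT'1
    · exact hne rfl
    · exact hMHnc (hmap' ▸ hcT T' (hKHO T' hT'1).1 y⁻¹)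
    · exact hMHnc (hmap ▸ hcT T (hKHO T hT1).1 y)
    · exact hne (hncHO T hT1 T' hT'1 ⟨y, hmap⟩)
  -- conjugation families on every Cartan representative (centralisers of `G`-regular elements are commutative)
  have hcommT : ∀ T : ↥SHall, ∀ a ∈ (T : Subgroup ((UnitaryGroup.cmDatum L 2 (Matrix.of fun i j : Fin 2 => if i.val + j.val + 1 = 2 then (1 : L) else 0)).Local v ×
      (UnitaryGroup.cmDatum L 1 (Matrix.of fun i j : Fin 1 => if i.val + j.val + 1 = 1 then (1 : L) else 0)).Local v)), ∀ b ∈ (T : Subgroup ((UnitaryGroup.cmDatum L 2 (Matrix.of fun i j : Fin 2 => if i.val + j.val + 1 = 2 then (1 : L) else 0)).Local v ×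
      (UnitaryGroup.cmDatum L 1 (Matrix.of fun i j : Fin 1 => if i.val + j.val + 1 = 1 then (1 : L) else 0)).Local v)), a * b = b * a := by
    intro T
    obtain ⟨γ₀, hγ₀, hT⟩ := hS T T.2
    rw [hT]
    exact centralizer_comm_of_isLocalGRegular L v γ₀ hγ₀
  let Φ : ∀ T : ↥SHall, (((UnitaryGroup.cmDatum L 2 (Matrix.of fun i j : Fin 2 => if i.val + j.val + 1 = 2 then (1 : L) else 0)).Local v ×
      (UnitaryGroup.cmDatum L 1 (Matrix.of fun i j : Fin 1 => if i.val + j.val + 1 = 1 then (1 : L) else 0)).Local v) ⧸ (T : Subgroup ((UnitaryGroup.cmDatum L 2 (Matrix.of fun i j : Fin 2 => if i.val + j.val + 1 = 2 then (1 : L) else 0)).Local v ×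
      (UnitaryGroup.cmDatum L 1 (Matrix.of fun i j : Fin 1 => if i.val + j.val + 1 = 1 then (1 : L) else 0)).Local v))) × ↥(T : Subgroup ((UnitaryGroup.cmDatum L 2 (Matrix.of fun i j : Fin 2 => if i.val + j.val + 1 = 2 then (1 : L) else 0)).Local v ×
      (UnitaryGroup.cmDatum L 1 (Matrix.of fun i j : Fin 1 => if i.val + j.val + 1 = 1 then (1 : L) else 0)).Local v)) → ((UnitaryGroup.cmDatum L 2 (Matrix.of fun i j : Fin 2 => if i.val + j.val + 1 = 2 then (1 : L) else 0)).Local v ×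
      (UnitaryGroup.cmDatum L 1 (Matrix.of fun i j : Fin 1 => if i.val + j.val + 1 = 1 then (1 : L) else 0)).Local v) :=
    fun T => (F0P3cStCharTSWeylHypMeasure.exists_conjFamily (T : Subgroup ((UnitaryGroup.cmDatum L 2 (Matrix.of fun i j : Fin 2 => if i.val + j.val + 1 = 2 then (1 : L) else 0)).Local v ×
      (UnitaryGroup.cmDatum L 1 (Matrix.of fun i j : Fin 1 => if i.val + j.val + 1 = 1 then (1 : L) else 0)).Local v)) (hcommT T)).choose
  have hΦ : ∀ (T : ↥SHall) (x : ((UnitaryGroup.cmDatum L 2 (Matrix.of fun i j : Fin 2 => if i.val + j.val + 1 = 2 then (1 : L) else 0)).Local v ×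
      (UnitaryGroup.cmDatum L 1 (Matrix.of fun i j : Fin 1 => if i.val + j.val + 1 = 1 then (1 : L) else 0)).Local v)) (t : ↥(T : Subgroup ((UnitaryGroup.cmDatum L 2 (Matrix.of fun i j : Fin 2 => if i.val + j.val + 1 = 2 then (1 : L) else 0)).Local v ×
      (UnitaryGroup.cmDatum L 1 (Matrix.of fun i j : Fin 1 => if i.val + j.val + 1 = 1 then (1 : L) else 0)).Local v))), Φ T (QuotientGroup.mk x, t) = x * t * x⁻¹ :=
    fun T => (F0P3cStCharTSWeylHypMeasure.exists_conjFamily (T : Subgroup ((UnitaryGroup.cmDatum L 2 (Matrix.of fun i j : Fin 2 => if i.val + j.val + 1 = 2 then (1 : L) else 0)).Local v ×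
      (UnitaryGroup.cmDatum L 1 (Matrix.of fun i j : Fin 1 => if i.val + j.val + 1 = 1 then (1 : L) else 0)).Local v)) (hcommT T)).choose_spec
  -- the torus measures: `μTHf` on `SH`, the ★ (H3d) measure on `M_H`
  let μ' : (T : Subgroup ((UnitaryGroup.cmDatum L 2 (Matrix.of fun i j : Fin 2 => if i.val + j.val + 1 = 2 then (1 : L) else 0)).Local v ×
      (UnitaryGroup.cmDatum L 1 (Matrix.of fun i j : Fin 1 => if i.val + j.val + 1 = 1 then (1 : L) else 0)).Local v)) → Measure ↥T := fun T =>
    if T ∈ SH then μTHf T else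
      if h : ∃ t : Measure ↥T, t.IsHaarMeasure ∧ t.IsInvInvariant ∧ t (compactCore ↥T) = 1 then h.choose else 0
  have hμ'SH : ∀ T ∈ SH, μ' T = μTHf T := fun T hT => by simp only [μ', hT, if_true]
  have hexM : ∃ t : Measure ↥MH, t.IsHaarMeasure ∧ t.IsInvInvariant ∧ t (compactCore ↥MH) = 1 :=
    F0P3cStCharTSUpTrOrbInt.exists_haar_cartanH_compactCore_eq_one hγM hMZ
  have hμ'MH : (μ' MH).IsHaarMeasure ∧ (μ' MH).IsInvInvariant ∧ μ' MH (compactCore ↥MH) = 1 := by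
    have e : μ' MH = hexM.choose := by simp only [μ', hMHnot, if_false, dif_pos hexM]
    rw [e]; exact hexM.choose_spec
  let tT : ∀ T : ↥SHall, Measure ↥(T : Subgroup ((UnitaryGroup.cmDatum L 2 (Matrix.of fun i j : Fin 2 => if i.val + j.val + 1 = 2 then (1 : L) else 0)).Local v ×
      (UnitaryGroup.cmDatum L 1 (Matrix.of fun i j : Fin 1 => if i.val + j.val + 1 = 1 then (1 : L) else 0)).Local v)) := fun T => μ' T
  have htTSH : ∀ (T : ↥SHall), (T : Subgroup ((UnitaryGroup.cmDatum L 2 (Matrix.of fun i j : Fin 2 => if i.val + j.val + 1 = 2 then (1 : L) else 0)).Local v ×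
      (UnitaryGroup.cmDatum L 1 (Matrix.of fun i j : Fin 1 => if i.val + j.val + 1 = 1 then (1 : L) else 0)).Local v)) ∈ SH → tT T = μTHf T := fun T h => hμ'SH T h
  haveI hHaarI : ∀ T : ↥SHall, (tT T).IsHaarMeasure := by
    rintro ⟨T, hT⟩
    rcases Finset.mem_insert.1 hT with rfl | h
    · exact hμ'MH.1
    · show (μ' T).IsHaarMeasure
      rw [hμ'SH T h]; exact hHaarHO T h
  haveI hInvI : ∀ T : ↥SHall, (tT T).IsInvInvariant := by
    rintro ⟨T, hT⟩
    rcases Finset.mem_insert.1 hT with rfl | h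
    · exact hμ'MH.2.1
    · show (μ' T).IsInvInvariant
      rw [hμ'SH T h]
      haveI := hHaarHO T h
      haveI : CompactSpace ↥T := isCompact_iff_compactSpace.1 (hKHO T h).1
      exact isInvInvariant_of_compactSpace (μTHf T)
  have htT : ∀ T : ↥SHall, tT T (compactCore ↥(T : Subgroup ((UnitaryGroup.cmDatum L 2 (Matrix.of fun i j : Fin 2 => if i.val + j.val + 1 = 2 then (1 : L) else 0)).Local v ×
      (UnitaryGroup.cmDatum L 1 (Matrix.of fun i j : Fin 1 => if i.val + j.val + 1 = 1 then (1 : L) else 0)).Local v))) = 1 := by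
    rintro ⟨T, hT⟩
    rcases Finset.mem_insert.1 hT with rfl | h
    · exact hμ'MH.2.2
    · show μ' T (compactCore ↥T) = 1
      rw [hμ'SH T h]
      haveI := hprobHO T h
      haveI : CompactSpace ↥T := isCompact_iff_compactSpace.1 (hKHO T h).1
      rw [compactCore_eq_univ, measure_univ]
  -- THE WEYL INTEGRATION FORMULA ON `H_v` (★ (H5‴)) at `f_H · 1`
  have hW := F0P3cStCharTSUpTrWIFHClosed.integral_mul_classFun_eq_finsetSum_DH_classOrbitalIntegral_H_of_splitSocket hns νHv SHall hS hcov hnc Φ hΦ tT htT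
    (F0P3cStCharTSUpTrWIFHFull.hJacNC_of_splitDock hns νHv SHall hS hcpt Φ hΦ tT htT) hcanH dh hdh fH (fun _ => (1 : ℂ)) hfm (fun _ _ _ => rfl)
    (by simpa only [mul_one] using hfi)
  have hL : ∫ y, fH y * (fun _ : ((UnitaryGroup.cmDatum L 2 (Matrix.of fun i j : Fin 2 => if i.val + j.val + 1 = 2 then (1 : L) else 0)).Local v ×
      (UnitaryGroup.cmDatum L 1 (Matrix.of fun i j : Fin 1 => if i.val + j.val + 1 = 1 then (1 : L) else 0)).Local v) => (1 : ℂ)) y ∂νHv = 1 := by simp only [mul_one]; exact hf1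
  rw [hL] at hW
  -- evaluate the summands
  have hsum : ∑ T : ↥SHall, ((Ch12Sec5.weylOrder (T : Subgroup ((UnitaryGroup.cmDatum L 2 (Matrix.of fun i j : Fin 2 => if i.val + j.val + 1 = 2 then (1 : L) else 0)).Local v ×
      (UnitaryGroup.cmDatum L 1 (Matrix.of fun i j : Fin 1 => if i.val + j.val + 1 = 1 then (1 : L) else 0)).Local v)) : ℂ))⁻¹ *
        ∫ s in {t : ↥(T : Subgroup ((UnitaryGroup.cmDatum L 2 (Matrix.of fun i j : Fin 2 => if i.val + j.val + 1 = 2 then (1 : L) else 0)).Local v ×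
      (UnitaryGroup.cmDatum L 1 (Matrix.of fun i j : Fin 1 => if i.val + j.val + 1 = 1 then (1 : L) else 0)).Local v)) | IsLocalGRegular L v (t : ((UnitaryGroup.cmDatum L 2 (Matrix.of fun i j : Fin 2 => if i.val + j.val + 1 = 2 then (1 : L) else 0)).Local v ×
      (UnitaryGroup.cmDatum L 1 (Matrix.of fun i j : Fin 1 => if i.val + j.val + 1 = 1 then (1 : L) else 0)).Local v))},
          ((dh (s : ((UnitaryGroup.cmDatum L 2 (Matrix.of fun i j : Fin 2 => if i.val + j.val + 1 = 2 then (1 : L) else 0)).Local v ×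
      (UnitaryGroup.cmDatum L 1 (Matrix.of fun i j : Fin 1 => if i.val + j.val + 1 = 1 then (1 : L) else 0)).Local v)) : ℂ) ^ 2 * classOrbitalIntegral mHv fH (ConjClasses.mk (s : ((UnitaryGroup.cmDatum L 2 (Matrix.of fun i j : Fin 2 => if i.val + j.val + 1 = 2 then (1 : L) else 0)).Local v ×
      (UnitaryGroup.cmDatum L 1 (Matrix.of fun i j : Fin 1 => if i.val + j.val + 1 = 1 then (1 : L) else 0)).Local v))) * (fun _ : ((UnitaryGroup.cmDatum L 2 (Matrix.of fun i j : Fin 2 => if i.val + j.val + 1 = 2 then (1 : L) else 0)).Local v ×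
      (UnitaryGroup.cmDatum L 1 (Matrix.of fun i j : Fin 1 => if i.val + j.val + 1 = 1 then (1 : L) else 0)).Local v) => (1 : ℂ)) (s : ((UnitaryGroup.cmDatum L 2 (Matrix.of fun i j : Fin 2 => if i.val + j.val + 1 = 2 then (1 : L) else 0)).Local v ×
      (UnitaryGroup.cmDatum L 1 (Matrix.of fun i j : Fin 1 => if i.val + j.val + 1 = 1 then (1 : L) else 0)).Local v))) ∂(tT T) =
      ∑ T ∈ SHall, ((Ch12Sec5.weylOrder T : ℂ))⁻¹ *
        ∫ s in {t : ↥T | IsLocalGRegular L v (t : ((UnitaryGroup.cmDatum L 2 (Matrix.of fun i j : Fin 2 => if i.val + j.val + 1 = 2 then (1 : L) else 0)).Local v ×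
      (UnitaryGroup.cmDatum L 1 (Matrix.of fun i j : Fin 1 => if i.val + j.val + 1 = 1 then (1 : L) else 0)).Local v))}, ((dh (s : ((UnitaryGroup.cmDatum L 2 (Matrix.of fun i j : Fin 2 => if i.val + j.val + 1 = 2 then (1 : L) else 0)).Local v ×
      (UnitaryGroup.cmDatum L 1 (Matrix.of fun i j : Fin 1 => if i.val + j.val + 1 = 1 then (1 : L) else 0)).Local v)) : ℂ) ^ 2 * classOrbitalIntegral mHv fH (ConjClasses.mk (s : ((UnitaryGroup.cmDatum L 2 (Matrix.of fun i j : Fin 2 => if i.val + j.val + 1 = 2 then (1 : L) else 0)).Local v ×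
      (UnitaryGroup.cmDatum L 1 (Matrix.of fun i j : Fin 1 => if i.val + j.val + 1 = 1 then (1 : L) else 0)).Local v)))) ∂(μ' T) := by
    rw [← Finset.sum_coe_sort SHall]
    refine Finset.sum_congr rfl fun T _ => ?_
    simp only [mul_one]
    rfl
  rw [hsum, Finset.sum_insert hMHnot] at hW
  -- the split term vanishes
  have hM0 : ∫ s in {t : ↥MH | IsLocalGRegular L v (t : ((UnitaryGroup.cmDatum L 2 (Matrix.of fun i j : Fin 2 => if i.val + j.val + 1 = 2 then (1 : L) else 0)).Local v ×
      (UnitaryGroup.cmDatum L 1 (Matrix.of fun i j : Fin 1 => if i.val + j.val + 1 = 1 then (1 : L) else 0)).Local v))}, ((dh (s : ((UnitaryGroup.cmDatum L 2 (Matrix.of fun i j : Fin 2 => if i.val + j.val + 1 = 2 then (1 : L) else 0)).Local v ×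
      (UnitaryGroup.cmDatum L 1 (Matrix.of fun i j : Fin 1 => if i.val + j.val + 1 = 1 then (1 : L) else 0)).Local v)) : ℂ) ^ 2 * classOrbitalIntegral mHv fH (ConjClasses.mk (s : ((UnitaryGroup.cmDatum L 2 (Matrix.of fun i j : Fin 2 => if i.val + j.val + 1 = 2 then (1 : L) else 0)).Local v ×
      (UnitaryGroup.cmDatum L 1 (Matrix.of fun i j : Fin 1 => if i.val + j.val + 1 = 1 then (1 : L) else 0)).Local v)))) ∂(μ' MH) = 0 := by
    refine setIntegral_eq_zero_of_forall_eq_zero fun s hs => ?_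
    have hZs : Subgroup.centralizer ({(s : ((UnitaryGroup.cmDatum L 2 (Matrix.of fun i j : Fin 2 => if i.val + j.val + 1 = 2 then (1 : L) else 0)).Local v ×
      (UnitaryGroup.cmDatum L 1 (Matrix.of fun i j : Fin 1 => if i.val + j.val + 1 = 1 then (1 : L) else 0)).Local v))} : Set ((UnitaryGroup.cmDatum L 2 (Matrix.of fun i j : Fin 2 => if i.val + j.val + 1 = 2 then (1 : L) else 0)).Local v ×
      (UnitaryGroup.cmDatum L 1 (Matrix.of fun i j : Fin 1 => if i.val + j.val + 1 = 1 then (1 : L) else 0)).Local v)) = MH :=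
      (F0P3cStCharTSUpTrCartanFields.centralizer_eq_of_mem_centralizer_of_isLocalGRegular L v hγM (hMZ ▸ s.2) hs).trans hMZ.symm
    rw [hfN (s : ((UnitaryGroup.cmDatum L 2 (Matrix.of fun i j : Fin 2 => if i.val + j.val + 1 = 2 then (1 : L) else 0)).Local v ×
      (UnitaryGroup.cmDatum L 1 (Matrix.of fun i j : Fin 1 => if i.val + j.val + 1 = 1 then (1 : L) else 0)).Local v)) hs (by rw [hZs]; exact hMHnc), mul_zero]
  rw [hM0, mul_zero, zero_add] at hW
  -- the compact terms: orbital integral `1`, full integral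
  rw [hW]
  refine Finset.sum_congr rfl fun T hT => ?_
  obtain ⟨γ₀, hγ₀, hTZ⟩ := (hKHO T hT).2
  haveI := hHaarHO T hT
  rw [hμ'SH T hT, ← F0P3cStCharTSEllMassHNull.setIntegral_setOf_isLocalGRegular_eq_integral L v hns hγ₀ hTZ (μTHf T)]
  congr 1
  refine setIntegral_congr_fun (F0P3cStCharTSUpTrWIFH.measurableSet_setOf_isLocalGRegular_subtype hns _) fun s hs => ?_
  have hZs : Subgroup.centralizer ({(s : ((UnitaryGroup.cmDatum L 2 (Matrix.of fun i j : Fin 2 => if i.val + j.val + 1 = 2 then (1 : L) else 0)).Local v ×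
      (UnitaryGroup.cmDatum L 1 (Matrix.of fun i j : Fin 1 => if i.val + j.val + 1 = 1 then (1 : L) else 0)).Local v))} : Set ((UnitaryGroup.cmDatum L 2 (Matrix.of fun i j : Fin 2 => if i.val + j.val + 1 = 2 then (1 : L) else 0)).Local v ×
      (UnitaryGroup.cmDatum L 1 (Matrix.of fun i j : Fin 1 => if i.val + j.val + 1 = 1 then (1 : L) else 0)).Local v)) = T :=
    (F0P3cStCharTSUpTrCartanFields.centralizer_eq_of_mem_centralizer_of_isLocalGRegular L v hγ₀ (hTZ ▸ s.2) hs).trans hTZ.symm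
  show ((dh (s : ((UnitaryGroup.cmDatum L 2 (Matrix.of fun i j : Fin 2 => if i.val + j.val + 1 = 2 then (1 : L) else 0)).Local v ×
      (UnitaryGroup.cmDatum L 1 (Matrix.of fun i j : Fin 1 => if i.val + j.val + 1 = 1 then (1 : L) else 0)).Local v)) : ℂ) ^ 2) = (dh (s : ((UnitaryGroup.cmDatum L 2 (Matrix.of fun i j : Fin 2 => if i.val + j.val + 1 = 2 then (1 : L) else 0)).Local v ×
      (UnitaryGroup.cmDatum L 1 (Matrix.of fun i j : Fin 1 => if i.val + j.val + 1 = 1 then (1 : L) else 0)).Local v)) : ℂ) ^ 2 * classOrbitalIntegral mHv fH (ConjClasses.mk (s : ((UnitaryGroup.cmDatum L 2 (Matrix.of fun i j : Fin 2 => if i.val + j.val + 1 = 2 then (1 : L) else 0)).Local v ×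
      (UnitaryGroup.cmDatum L 1 (Matrix.of fun i j : Fin 1 => if i.val + j.val + 1 = 1 then (1 : L) else 0)).Local v)))
  rw [hfE (s : ((UnitaryGroup.cmDatum L 2 (Matrix.of fun i j : Fin 2 => if i.val + j.val + 1 = 2 then (1 : L) else 0)).Local v ×
      (UnitaryGroup.cmDatum L 1 (Matrix.of fun i j : Fin 1 => if i.val + j.val + 1 = 1 then (1 : L) else 0)).Local v)) hs (by rw [hZs]; exact (hKHO T hT).1), mul_one]

/-! ## §2 The fence-(α) head: the elliptic Weyl mass of `H_v` is one -/

set_option maxHeartbeats 1600000 in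
set_option synthInstance.maxHeartbeats 400000 in
-- instance-term unification on the endoscopic local carrier, as §1
/-- **THE ELLIPTIC WEYL MASS OF `H_v` IS ONE** (`v` non-split): for the RUNG 0 Cartan data `SH, μTHf` (binders `hKHO hcovHO hncHO hHaarHO hprobHO` of ★ `F0P3cStCharTSRung0Eight` :143–:147
verbatim) and the closed form `dh = D_H` (`hdh` = the block's `eDH` :167 with `𝔇.DH ↦ dh`),
**`Σ_{T ∈ SH} (weylOrder T)⁻¹ · ∫_T (dh t)² dμTHf(T) = 1`** — the `hmass` input of ★ (B6) `packetCharHNorm_of_ellipticWeylMass`, hence (M5) `𝔇.PacketCharHNorm` at the pins.  No measure on `H_v`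
in the statement: a Haar measure and a canonical orbital family are chosen inside (★ `isMulRightInvariant_localEndoscopic`, ★ `OrbitalMeasureFamily.exists_isCanonical`, ★ (H3d)), Kottwitz's
Euler–Poincaré function is ★ (B3) `exists_epFunction_H`, and §1 concludes.
[cite: Rogawski1990, §12.5 p. 184; Cor. 12.5.4 proof p. 186] [cite: Kottwitz1988, §2 Theorem 2] [cite: HarishChandra1970, Lemma 22; Lemma 42] -/
theorem ellipticWeylMass_H_eq_one (hns : ∀ w : PlacesOver L v, IsCMField.complexConj L • w.1 = w.1)
    [MeasurableSpace ((UnitaryGroup.cmDatum L 2 (Matrix.of fun i j : Fin 2 => if i.val + j.val + 1 = 2 then (1 : L) else 0)).Local v ×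
      (UnitaryGroup.cmDatum L 1 (Matrix.of fun i j : Fin 1 => if i.val + j.val + 1 = 1 then (1 : L) else 0)).Local v)] [BorelSpace ((UnitaryGroup.cmDatum L 2 (Matrix.of fun i j : Fin 2 => if i.val + j.val + 1 = 2 then (1 : L) else 0)).Local v ×
      (UnitaryGroup.cmDatum L 1 (Matrix.of fun i j : Fin 1 => if i.val + j.val + 1 = 1 then (1 : L) else 0)).Local v)]
    (SH : Finset (Subgroup ((UnitaryGroup.cmDatum L 2 (Matrix.of fun i j : Fin 2 => if i.val + j.val + 1 = 2 then (1 : L) else 0)).Local v ×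
      (UnitaryGroup.cmDatum L 1 (Matrix.of fun i j : Fin 1 => if i.val + j.val + 1 = 1 then (1 : L) else 0)).Local v))) (μTHf : (T' : Subgroup ((UnitaryGroup.cmDatum L 2 (Matrix.of fun i j : Fin 2 => if i.val + j.val + 1 = 2 then (1 : L) else 0)).Local v ×
      (UnitaryGroup.cmDatum L 1 (Matrix.of fun i j : Fin 1 => if i.val + j.val + 1 = 1 then (1 : L) else 0)).Local v)) → Measure ↥T')
    (hKHO : ∀ T' ∈ SH, IsCompact (T' : Set ((UnitaryGroup.cmDatum L 2 (Matrix.of fun i j : Fin 2 => if i.val + j.val + 1 = 2 then (1 : L) else 0)).Local v ×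
      (UnitaryGroup.cmDatum L 1 (Matrix.of fun i j : Fin 1 => if i.val + j.val + 1 = 1 then (1 : L) else 0)).Local v)) ∧ ∃ γ₀ : (UnitaryGroup.cmDatum L 2 (Matrix.of fun i j : Fin 2 => if i.val + j.val + 1 = 2 then (1 : L) else 0)).Local v ×
      (UnitaryGroup.cmDatum L 1 (Matrix.of fun i j : Fin 1 => if i.val + j.val + 1 = 1 then (1 : L) else 0)).Local v, IsLocalGRegular L v γ₀ ∧ T' = Subgroup.centralizer ({γ₀} : Set ((UnitaryGroup.cmDatum L 2 (Matrix.of fun i j : Fin 2 => if i.val + j.val + 1 = 2 then (1 : L) else 0)).Local v ×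
      (UnitaryGroup.cmDatum L 1 (Matrix.of fun i j : Fin 1 => if i.val + j.val + 1 = 1 then (1 : L) else 0)).Local v)))
    (hcovHO : ∀ γ₀ : (UnitaryGroup.cmDatum L 2 (Matrix.of fun i j : Fin 2 => if i.val + j.val + 1 = 2 then (1 : L) else 0)).Local v ×
      (UnitaryGroup.cmDatum L 1 (Matrix.of fun i j : Fin 1 => if i.val + j.val + 1 = 1 then (1 : L) else 0)).Local v, IsLocalGRegular L v γ₀ → IsCompact ((Subgroup.centralizer ({γ₀} : Set ((UnitaryGroup.cmDatum L 2 (Matrix.of fun i j : Fin 2 => if i.val + j.val + 1 = 2 then (1 : L) else 0)).Local v ×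
      (UnitaryGroup.cmDatum L 1 (Matrix.of fun i j : Fin 1 => if i.val + j.val + 1 = 1 then (1 : L) else 0)).Local v)) : Subgroup ((UnitaryGroup.cmDatum L 2 (Matrix.of fun i j : Fin 2 => if i.val + j.val + 1 = 2 then (1 : L) else 0)).Local v ×
      (UnitaryGroup.cmDatum L 1 (Matrix.of fun i j : Fin 1 => if i.val + j.val + 1 = 1 then (1 : L) else 0)).Local v)) : Set ((UnitaryGroup.cmDatum L 2 (Matrix.of fun i j : Fin 2 => if i.val + j.val + 1 = 2 then (1 : L) else 0)).Local v ×
      (UnitaryGroup.cmDatum L 1 (Matrix.of fun i j : Fin 1 => if i.val + j.val + 1 = 1 then (1 : L) else 0)).Local v)) →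
      ∃ T ∈ SH, ∃ x : (UnitaryGroup.cmDatum L 2 (Matrix.of fun i j : Fin 2 => if i.val + j.val + 1 = 2 then (1 : L) else 0)).Local v ×
      (UnitaryGroup.cmDatum L 1 (Matrix.of fun i j : Fin 1 => if i.val + j.val + 1 = 1 then (1 : L) else 0)).Local v, Subgroup.centralizer ({x * γ₀ * x⁻¹} : Set ((UnitaryGroup.cmDatum L 2 (Matrix.of fun i j : Fin 2 => if i.val + j.val + 1 = 2 then (1 : L) else 0)).Local v ×
      (UnitaryGroup.cmDatum L 1 (Matrix.of fun i j : Fin 1 => if i.val + j.val + 1 = 1 then (1 : L) else 0)).Local v)) = T)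
    (hncHO : ∀ T' ∈ SH, ∀ T'' ∈ SH, (∃ x : (UnitaryGroup.cmDatum L 2 (Matrix.of fun i j : Fin 2 => if i.val + j.val + 1 = 2 then (1 : L) else 0)).Local v ×
      (UnitaryGroup.cmDatum L 1 (Matrix.of fun i j : Fin 1 => if i.val + j.val + 1 = 1 then (1 : L) else 0)).Local v, T'.map (MulAut.conj x).toMonoidHom = T'') → T' = T'')
    (hHaarHO : ∀ T' ∈ SH, (μTHf T').IsHaarMeasure) (hprobHO : ∀ T' ∈ SH, IsProbabilityMeasure (μTHf T'))
    (dh : ((UnitaryGroup.cmDatum L 2 (Matrix.of fun i j : Fin 2 => if i.val + j.val + 1 = 2 then (1 : L) else 0)).Local v ×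
      (UnitaryGroup.cmDatum L 1 (Matrix.of fun i j : Fin 1 => if i.val + j.val + 1 = 1 then (1 : L) else 0)).Local v) → ℝ)
    (hdh : ∀ s : (UnitaryGroup.cmDatum L 2 (Matrix.of fun i j : Fin 2 => if i.val + j.val + 1 = 2 then (1 : L) else 0)).Local v ×
      (UnitaryGroup.cmDatum L 1 (Matrix.of fun i j : Fin 1 => if i.val + j.val + 1 = 1 then (1 : L) else 0)).Local v, dh s = ((NNReal.sqrt (NNReal.sqrt ((∏ w : PlacesOver L v, IsNonarchimedeanLocalField.normAbs (w.1.adicCompletion L) (((s.1.val : GL (Fin 2) (UnitaryGroup.LocalRing L v)).val.charpoly.discr) w)) * (∏ w : PlacesOver L v, IsNonarchimedeanLocalField.normAbs (w.1.adicCompletion L) (((s.1.val : GL (Fin 2) (UnitaryGroup.LocalRing L v)).val.det) w))⁻¹)) : ℝ≥0) : ℝ)) :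
    ∑ T ∈ SH, ((Ch12Sec5.weylOrder T : ℂ))⁻¹ * ∫ t : ↥T, ((dh (t : ((UnitaryGroup.cmDatum L 2 (Matrix.of fun i j : Fin 2 => if i.val + j.val + 1 = 2 then (1 : L) else 0)).Local v ×
      (UnitaryGroup.cmDatum L 1 (Matrix.of fun i j : Fin 1 => if i.val + j.val + 1 = 1 then (1 : L) else 0)).Local v)) : ℂ) ^ 2) ∂(μTHf T) = 1 := by
  -- Borel structures on the orbit spaces, a Haar measure, a canonical family — introduced here, absent from the statement (fence (α))
  letI : ∀ a : (UnitaryGroup.cmDatum L 2 (Matrix.of fun i j : Fin 2 => if i.val + j.val + 1 = 2 then (1 : L) else 0)).Local v ×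
      (UnitaryGroup.cmDatum L 1 (Matrix.of fun i j : Fin 1 => if i.val + j.val + 1 = 1 then (1 : L) else 0)).Local v, MeasurableSpace (((UnitaryGroup.cmDatum L 2 (Matrix.of fun i j : Fin 2 => if i.val + j.val + 1 = 2 then (1 : L) else 0)).Local v ×
      (UnitaryGroup.cmDatum L 1 (Matrix.of fun i j : Fin 1 => if i.val + j.val + 1 = 1 then (1 : L) else 0)).Local v) ⧸ Subgroup.centralizer ({a} : Set ((UnitaryGroup.cmDatum L 2 (Matrix.of fun i j : Fin 2 => if i.val + j.val + 1 = 2 then (1 : L) else 0)).Local v ×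
      (UnitaryGroup.cmDatum L 1 (Matrix.of fun i j : Fin 1 => if i.val + j.val + 1 = 1 then (1 : L) else 0)).Local v))) := fun _ => borel _
  haveI : ∀ a : (UnitaryGroup.cmDatum L 2 (Matrix.of fun i j : Fin 2 => if i.val + j.val + 1 = 2 then (1 : L) else 0)).Local v ×
      (UnitaryGroup.cmDatum L 1 (Matrix.of fun i j : Fin 1 => if i.val + j.val + 1 = 1 then (1 : L) else 0)).Local v, BorelSpace (((UnitaryGroup.cmDatum L 2 (Matrix.of fun i j : Fin 2 => if i.val + j.val + 1 = 2 then (1 : L) else 0)).Local v ×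
      (UnitaryGroup.cmDatum L 1 (Matrix.of fun i j : Fin 1 => if i.val + j.val + 1 = 1 then (1 : L) else 0)).Local v) ⧸ Subgroup.centralizer ({a} : Set ((UnitaryGroup.cmDatum L 2 (Matrix.of fun i j : Fin 2 => if i.val + j.val + 1 = 2 then (1 : L) else 0)).Local v ×
      (UnitaryGroup.cmDatum L 1 (Matrix.of fun i j : Fin 1 => if i.val + j.val + 1 = 1 then (1 : L) else 0)).Local v))) := fun _ => ⟨rfl⟩
  let νHv : Measure ((UnitaryGroup.cmDatum L 2 (Matrix.of fun i j : Fin 2 => if i.val + j.val + 1 = 2 then (1 : L) else 0)).Local v ×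
      (UnitaryGroup.cmDatum L 1 (Matrix.of fun i j : Fin 1 => if i.val + j.val + 1 = 1 then (1 : L) else 0)).Local v) := Measure.haar
  haveI : νHv.IsMulRightInvariant := isMulRightInvariant_localEndoscopic L v νHv
  obtain ⟨mHv, hcanH⟩ := OrbitalMeasureFamily.exists_isCanonical (G := (UnitaryGroup.cmDatum L 2 (Matrix.of fun i j : Fin 2 => if i.val + j.val + 1 = 2 then (1 : L) else 0)).Local v ×
      (UnitaryGroup.cmDatum L 1 (Matrix.of fun i j : Fin 1 => if i.val + j.val + 1 = 1 then (1 : L) else 0)).Local v) (IsLocalGRegular L v) νHv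
    (F0P3cStCharTSUpTrOrbInt.forall_isLocalGRegular_exists_isHaarMeasure_compactCore_centralizer_eq_one (L := L) (v := v))
  -- Kottwitz's Euler–Poincaré function on `H_v` (★ (B3))
  obtain ⟨fH, -, hfm, hfi, hf1, hfE, hfN⟩ := F0P3cStCharTSEllMassHEP.exists_epFunction_H L v νHv hns hcanH
  exact ellipticWeylMass_H_eq_one_of_epFunction L v hns νHv hcanH SH μTHf hKHO hcovHO hncHO hHaarHO hprobHO dh hdh fH hfm hfi hf1 hfE hfN

end CM

end Summit.HodgeConjecture.HodgeConjecture.Cruxes.H413.F0P3cStCharTSEllMassH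

end
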